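import Summits.BirchSwinnertonDyer.BirchSwinnertonDyer.Theorems.TwoAdicConverseOrdLambdaHalfAtTwoGL1CycLineKLNumerator
import Summits.BirchSwinnertonDyer.Rank1Residual.X1.MuLambdaAlgebra
import HarnessLib

/-!
# The trivial-character factor of the cyclotomic line at `2`: `λ(T) = 1`, `λ(T·g) = 1 + λ(g)`, `λ(½·klTwoNumerator) = 0`,
# and the depleted `2`-adic zeta numerator `G⁰_{M,c}` (crux `OrdLambdaHalfAtTwo`, item stmt-BirchSwinnertonDyer-19556, line `kato_determinant_greenberg_two`, v5
# component D2 «cyc-line GL(1) analytic side at 2», pen RC-351 (3))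

HONEST FRAMING.  Helper file (`--supports stmt-BirchSwinnertonDyer-19556 --as helper`); proves nothing about an
elliptic curve; BSD is not proved by any of this.  For the tree's `λ`-invariant `X1.MuLambda.lam` on `Λ = ℤ₂⟦T⟧`
(order of `pfree g mod 2`): `mu_X`, `pfree_X`, **`lam_X : λ(T) = 1`**, **`lam_X_mul : λ(T·g) = 1 + λ(g)`** (`g ≠ 0`)
— the currency in which the TRIVIAL ZERO `T ∣ ½G⁺` of `…GL1CycLineKLQuad` is «an explicit λ-shift» —,
`one_le_lam_of_X_dvd`, `lam_eq_zero_of_isUnit`, and **`λ(½·klTwoNumerator) = 0`**: the `2`-adic zeta numerator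
`G⁰ = ∫(1+T)^ℓ d(χ₋₄E_{1,5})` has `½G⁰` a UNIT of `Λ` (`G⁰(0) = 2`, tree), so in Gross's factorisation
`L^{Katz}_2|_{cyc}(s) = L₂(ε_Kω, s)·ζ₂(1 − s)` (Invent. Math. 57 (1980); at `p = 2`: Kriz–Li 2019 Lemma 7.6) the
`ζ₂`-factor contributes `λ(½G⁰) − λ(1 − 5(1+T)) = 0 − 1 = −1` (the regulariser `1 − ⟨5⟩^{s+1}`, `λ = 1`, cancels
the pole of `ζ₂` at `1 − s = 1`; Washington Thm. 7.10 / §7.2).  §3: `trivOddChar M : ℤ/4M → ℤ₂`,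
`x ↦ χ₋₄(x)·𝟙[x unit]` (`ω⁻¹ = χ₋₄` depleted at the odd primes of `M`) and `trivTwoNumerator M c = G⁰_{M,c}`, the
numerator of the `M`-depleted `2`-adic zeta function (the companion `…GL1CycLineKLNumerator`'s `twoKLNumerator`), with
`½G⁰ ∈ Λ` and `trivTwoNumerator 1 5 = klTwoNumerator`.  No `sorry`, no named fact, no instance, no notation.

References: [Washington1997] §7.1 (μ, λ, distinguished polynomials), §7.2 and Thm. 7.10 (p = 2);
[LangCyclotomic1990] Ch. 4 §3 Thm. 3.2; [Gross1980Factorization] Invent. Math. 57 (1980) 83–95; [KrizLi2019]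
Forum Math. Sigma 7 (2019) e15, Lemma 7.6.
-/

noncomputable section

open scoped Classical

open Filter Topology Finset
open Literature.NumberTheory.EllipticCurves

set_option autoImplicit false
set_option linter.dupNamespace false

namespace Summit.BirchSwinnertonDyer.BirchSwinnertonDyer.Theorems.TwoAdicGL1CycLine

/-! ## §1 The `λ`-invariant of `T` (for the trivial-zero shift `λ(T·g) = 1 + λ(g)`) -/

section Lambda

open Summit.BirchSwinnertonDyer.Rank1Residual.X1.MuLambda

/-- `μ(T) = 0`: no positive power of `2` divides `T` in `Λ`. [cite: Washington1997, §7.1 (μ of a distinguished polynomial)] -/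
theorem mu_X : mu (PowerSeries.X : IwasawaAlgebra 2) = 0 := by
  have hX : (PowerSeries.X : IwasawaAlgebra 2) ≠ 0 := PowerSeries.X_ne_zero
  by_contra h
  have h1 : 1 ≤ mu (PowerSeries.X : IwasawaAlgebra 2) := Nat.one_le_iff_ne_zero.mpr h
  have hdvd := C_pow_mu_dvd hX
  have hdvd' : (PowerSeries.C (((2 : ℕ) : ℤ_[2]) ^ 1) : IwasawaAlgebra 2) ∣ PowerSeries.X :=
    dvd_trans (map_dvd PowerSeries.C (pow_dvd_pow _ h1)) hdvd
  rw [pow_one] at hdvd'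
  obtain ⟨g, hg⟩ := hdvd'
  have h2 := congr_arg (PowerSeries.coeff 1) hg
  rw [PowerSeries.coeff_one_X, PowerSeries.coeff_C_mul] at h2
  have h3 : ‖((2 : ℕ) : ℤ_[2]) * PowerSeries.coeff 1 g‖ < 1 := by
    rw [norm_mul]
    calc ‖((2 : ℕ) : ℤ_[2])‖ * ‖PowerSeries.coeff 1 g‖ ≤ ‖((2 : ℕ) : ℤ_[2])‖ * 1 :=
          mul_le_mul_of_nonneg_left (PadicInt.norm_le_one _) (norm_nonneg _)
      _ < 1 := by
          rw [mul_one, PadicInt.norm_lt_one_iff_dvd]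
  rw [← h2, norm_one] at h3
  exact lt_irrefl _ h3

/-- `pfree T = T`. [cite: Washington1997, §7.1] -/
theorem pfree_X : pfree (PowerSeries.X : IwasawaAlgebra 2) = PowerSeries.X := by
  have h := eq_C_pow_mu_mul_pfree (PowerSeries.X : IwasawaAlgebra 2)
  rw [mu_X, pow_zero, map_one, one_mul] at h
  exact h.symm

/-- **`λ(T) = 1`.** [cite: Washington1997, §7.1 (λ = Weierstrass degree)] -/
theorem lam_X : lam (PowerSeries.X : IwasawaAlgebra 2) = 1 := by
  rw [lam, pfree_X, red, PowerSeries.map_X, PowerSeries.order_X]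
  rfl

/-- **The trivial-zero shift: `λ(T·g) = 1 + λ(g)`** for `g ≠ 0`. [cite: Washington1997, §7.1] -/
theorem lam_X_mul {g : IwasawaAlgebra 2} (hg : g ≠ 0) :
    lam ((PowerSeries.X : IwasawaAlgebra 2) * g) = 1 + lam g := by
  rw [lam_mul PowerSeries.X_ne_zero hg, lam_X]

/-- **`λ(g) ≥ 1` whenever `T ∣ g ≠ 0`.** [cite: Washington1997, §7.1] -/
theorem one_le_lam_of_X_dvd {g : IwasawaAlgebra 2} (hg : g ≠ 0)
    (hX : (PowerSeries.X : IwasawaAlgebra 2) ∣ g) : 1 ≤ lam g := by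
  obtain ⟨h, rfl⟩ := hX
  have hh : h ≠ 0 := fun hh ↦ hg (by rw [hh, mul_zero])
  rw [lam_X_mul hh]
  exact Nat.le_add_right 1 _

/-- **A unit of `Λ` has `λ = 0`** (and `μ = 0`). [cite: Washington1997, §7.1] -/
theorem lam_eq_zero_of_isUnit {g : IwasawaAlgebra 2} (hg : IsUnit g) : lam g = 0 :=
  ((isUnit_iff_mu_eq_zero_and_lam_eq_zero g).mp hg).2.2

end Lambda

/-! ## §2 The trivial character: `½·klTwoNumerator` is a UNIT of `Λ` (`λ = 0`; the `ζ₂`-factor of Gross) -/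

section Trivial

open Summit.BirchSwinnertonDyer.Rank1Residual.X1.MuLambda

/-- **`½G` for `G = klTwoNumerator = ∫(1+T)^ℓ d(χ₋₄E_{1,5})` is a UNIT of `Λ`**: `G(0) = 2` (tree
`constantCoeff_klTwoNumerator_eq_two`).  Dictionary (PRINT): `G(5^s − 1) = −(1 − 5^{s+1})·ζ₂(−s)`, the
regulariser `1 − ⟨5⟩(1+T)` (`λ = 1`) cancelling the pole of the `2`-adic zeta function at `−s = 1`; so on the
cyclotomic line of Gross's factorisation the `ζ₂(1 − s)`-factor contributes `λ(½G) − λ(1 − 5(1+T)) = 0 − 1 = −1`.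
[cite: Washington1997, §7.2 (p = 2) and Thm. 7.10] [cite: LangCyclotomic1990, Ch. 4 §3 Thm. 3.2 (PDF p. 84)] -/
theorem isUnit_halfLift_klTwoNumerator :
    IsUnit (halfLift klTwoNumerator norm_coeff_klTwoNumerator_le_half) := by
  rw [isUnit_halfLift_iff, constantCoeff_klTwoNumerator_eq_two]
  have h := @Padic.norm_p 2 _
  push_cast at h
  exact h

/-- **`λ(½·klTwoNumerator) = 0`.** [cite: Washington1997, §7.2 and Thm. 7.10 (p = 2)] -/
theorem lam_halfLift_klTwoNumerator :
    lam (halfLift klTwoNumerator norm_coeff_klTwoNumerator_le_half) = 0 :=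
  lam_eq_zero_of_isUnit isUnit_halfLift_klTwoNumerator

end Trivial

/-! ## §3 The depleted trivial character `χ₋₄·𝟙_{(·,4M)=1}` on `ℤ/4M` and the numerator `G⁰` -/

section Triv

/-- **`θ⁰_M : ℤ/4M → ℤ₂`, `x ↦ χ₋₄(x)` on the units and `0` elsewhere** — `ω⁻¹ = χ₋₄` depleted at the odd primes
dividing `M`: the `θ = χω⁻¹` of the Kubota–Leopoldt measure for the TRIVIAL character `χ = 𝟙` (`M`-depleted
`2`-adic zeta function).  For `M = 1` this is the `χ₋₄` of the tree's `klTwoMeasure`.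
[cite: LangCyclotomic1990, Ch. 4 §3 (θ = χω⁻¹; PDF p. 84)] [cite: Washington1997, §7.2 (p = 2)] -/
def trivOddChar (M : ℕ) : ZMod (4 * M) → ℤ_[2] :=
  fun x ↦ if IsUnit x then chiMinusFour 2 x.val else 0

/-- **`G⁰_{M,c}(T) = ∫_{ℤ₂^×}(1+T)^{ℓ(x)} d(θ⁰_M E_{1,c})(x)`** — the numerator of the `M`-depleted `2`-adic zeta
function (`G⁰(5^s − 1) = −(1 − ⟨c⟩^{s+1}ω(c)…)·ζ₂^{(M)}(−s)`, PRINT), the second Kubota–Leopoldt factor of Gross's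
factorisation on the cyclotomic line at `2` (there in the reflected variable `1 − s`).
[cite: LangCyclotomic1990, Ch. 4 §3 Thm. 3.2 (PDF p. 84)] [cite: Gross1980Factorization, main theorem (χ = 1)] -/
def trivTwoNumerator (M c : ℕ) [NeZero M] : PowerSeries ℚ_[2] :=
  twoKLNumerator (trivOddChar M) c

variable {M : ℕ} [NeZero M]

omit [NeZero M] in
/-- `θ⁰` vanishes on the even integers. [cite: LangCyclotomic1990, Ch. 2 §2 (PDF p. 36)] -/
theorem trivOddChar_natCast_of_two_dvd (b : ℕ) (hb : 2 ∣ b) : trivOddChar M (b : ZMod (4 * M)) = 0 := by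
  unfold trivOddChar
  rw [if_neg]
  intro hu
  have h := (ZMod.isUnit_iff_coprime b (4 * M)).mp hu
  have h2 : Nat.Coprime 2 (4 * M) := Nat.Coprime.coprime_dvd_left hb h
  have h4 : Nat.Coprime 2 4 := Nat.Coprime.coprime_mul_right_right h2
  norm_num at h4

/-- `θ⁰` is ODD: `θ⁰(−x) = −θ⁰(x)` (`χ₋₄` is odd, `4 ∣ 4M`). [cite: LangCyclotomic1990, Ch. 2 §2 (odd characters, PDF p. 36)] -/
theorem trivOddChar_neg (x : ZMod (4 * M)) : trivOddChar M (-x) = -trivOddChar M x := by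
  haveI : Fact (1 < 4 * M) := ⟨by have := NeZero.pos M; omega⟩
  unfold trivOddChar
  by_cases hx : IsUnit x
  · rw [if_pos hx.neg, if_pos hx]
    have hx0 : x ≠ 0 := hx.ne_zero
    rw [ZMod.neg_val, if_neg hx0]
    exact chiMinusFour_sub_of_four_dvd 2 (dvd_mul_right 4 M) (ZMod.val_lt x).le
  · have hnx : ¬ IsUnit (-x) := fun h ↦ hx (neg_neg x ▸ h.neg)
    rw [if_neg hnx, if_neg hx, neg_zero]

omit [NeZero M] in
/-- `c` prime to `2M` is prime to the level `4M · 2`. [folklore] -/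
private theorem coprime_level_four {c : ℕ} (hc : c.Coprime (2 * M)) : c.Coprime (4 * M * 2) := by
  have h2 : c.Coprime 2 := Nat.Coprime.coprime_mul_right_right hc
  have hM : c.Coprime M := Nat.Coprime.coprime_mul_left_right hc
  rw [show 4 * M * 2 = 2 * 2 * 2 * M by ring]
  exact Nat.Coprime.mul_right (Nat.Coprime.mul_right (Nat.Coprime.mul_right h2 h2) h2) hM

/-- **`½G⁰ ∈ Λ`**: `‖[T^k]G⁰‖₂ ≤ ½` for `c` prime to `2M`. [cite: MazurTateTeitelbaum1986Invent, §I.12–I.13 (p = 2)] -/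
theorem norm_coeff_trivTwoNumerator_le_half {c : ℕ} (hc : c.Coprime (2 * M)) (k : ℕ) :
    ‖PowerSeries.coeff k (trivTwoNumerator M c)‖ ≤ 2⁻¹ :=
  norm_coeff_twoKLNumerator_le_half (coprime_level_four hc) trivOddChar_neg k

/-- **At `M = 1`, `c = 5` the depleted trivial numerator IS the tree's `klTwoNumerator`** (`θ⁰_1 = χ₋₄` on the
integers: `χ₋₄` has period `4` and vanishes on the even numbers).
[cite: LangCyclotomic1990, Ch. 4 §3 (the measure χ₋₄E_{1,5}, PDF p. 84)] -/
theorem trivTwoNumerator_one_five : trivTwoNumerator 1 5 = klTwoNumerator := by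
  have hθ : charFun (trivOddChar 1) = chiMinusFour 2 := by
    funext b
    simp only [charFun, trivOddChar]
    by_cases hb : b.Coprime (4 * 1)
    · rw [if_pos ((ZMod.isUnit_iff_coprime b (4 * 1)).mpr hb), ZMod.val_natCast]
      unfold chiMinusFour
      rw [show (4 * 1 : ℕ) = 4 from rfl, ZMod.natCast_mod]
    · rw [if_neg (fun hu ↦ hb ((ZMod.isUnit_iff_coprime b (4 * 1)).mp hu))]
      have h2 : 2 ∣ b := by
        by_contra h
        apply hb
        have hodd : Odd b := Nat.odd_iff.mpr (by omega)
        rw [show 4 * 1 = 2 ^ 2 by norm_num]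
        exact Nat.Coprime.pow_right 2 (Nat.coprime_two_right.mpr hodd)
      exact (chiMinusFour_eq_zero_of_two_dvd 2 h2).symm
  show distributionTransform (bernoulliMeasure 2 (4 * 1) 5 (charFun (trivOddChar 1)) 1) =
    distributionTransform (bernoulliMeasure 2 4 5 (chiMinusFour 2) 1)
  rw [hθ]

end Triv

end Summit.BirchSwinnertonDyer.BirchSwinnertonDyer.Theorems.TwoAdicGL1CycLine

end
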